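import Mathlib
import HarnessLib
import Summits.NavierStokesRegularity.NavierStokesRegularity.Theorems.AdiabaticEddyFrozenEddyAxisymOffAxis
import Summits.NavierStokesRegularity.NavierStokesRegularity.Theorems.StretchingWellBindingEnstrophyQuarterLawSparsenessTools

/-!
# Shelf 1574, line `sparse_sieve`: uniform sparseness at EARLY times (all scales, every threshold)

Helper file (`--supports stmt-NavierStokesRegularity-1574 --as helper`), the early-time part of the no-loss
certificate for stub S2 `UniformSparseness` of `Cruxes/EnstrophyQuarterLaw/Lines/sparse_sieve.lean` (companion
of `…EnstrophyQuarterLawSparseness.sparse_fine_of_window`, which treats late times at fine scales):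

* `sparse_early_of_lerayHopf` — for a classical solution on `[0, T)` (`ν > 0`), Leray–Hopf on `[0, T]` from a
  rapidly decaying datum, and `T' < T`: for every `ε₀ > 0` there is `N₀` such that at every time
  `t ∈ [0, T']` and EVERY scale `r > 0`, every `4r`-separated finite family of centres `x` with
  `∫_{B(x, 2r)} |u(t)|³ ≥ ε₀³` has at most `N₀` members. No window law is needed here: the solution is
  bounded by some `V` on the closed sub-slab (`bounded_subslab_of_lerayHopf`), so
  `Σ_x ∫_{B(x,2r)} |u|³ ≤ 8 ∫ |u(t)|³ ≤ 8 V ∫ |u(t)|² ≤ 16 V E₀` (bounded overlap of the balls,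
  `SparsenessTools.sum_setLIntegral_ball_le_of_separated`; Leray–Hopf energy bound), whence
  `N₀ = ⌊16 V E₀ / ε₀³⌋`.

HONEST FRAMING: elementary bookkeeping about ONE hypothetical solution; nothing here bears on the regularity
problem; `EnstrophyQuarterLaw` (1574) and `UniformSparseness` (S2) stay OPEN. No summit statement is proved.
-/

noncomputable section

-- the summit-side namespace repeats a component by design (D-0017)
set_option linter.dupNamespace false

namespace Summit.NavierStokesRegularity.NavierStokesRegularity.Theorems.EnstrophyQuarterLaw.SparsenessEarly

open Set MeasureTheory Function Metric Filter Topology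
open scoped ENNReal NNReal
open Literature.Analysis.FluidPDE

variable {ν T : ℝ} {u : ℝ → EuclideanSpace ℝ (Fin 3) → EuclideanSpace ℝ (Fin 3)}
  {p : ℝ → EuclideanSpace ℝ (Fin 3) → ℝ}

/-- **Uniform sparseness at early times.** For a classical solution on `[0, T)` (`ν > 0`), Leray–Hopf on
`[0, T]` from a rapidly decaying datum, and `0 < T' < T`: for every `ε₀ > 0` there is `N₀ ∈ ℕ` such that for
all `t ∈ [0, T']`, all `r > 0` and every finite `4r`-separated family `F` of centres with
`∫_{B(x, 2r)} |u(t)|³ ≥ ε₀³` (`x ∈ F`), `card F ≤ N₀` (sup bound on the sub-slab, bounded overlap, energy).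
[folklore] -/
theorem sparse_early_of_lerayHopf (hν : 0 < ν)
    (hsol : IsClassicalNSSolutionOn (Ico 0 T) ν 0 u p) (hLH : IsLerayHopfOn T ν 0 (u 0) u)
    (hdec : HasRapidSpatialDecay (u 0)) {T' : ℝ} (hT' : T' ∈ Ioo 0 T) :
    ∀ ε₀ : ℝ, 0 < ε₀ → ∃ N₀ : ℕ, ∀ t ∈ Icc 0 T', ∀ r : ℝ, 0 < r →
      ∀ F : Finset (EuclideanSpace ℝ (Fin 3)),
        (∀ x ∈ F, ∀ y ∈ F, x ≠ y → 4 * r ≤ dist x y) →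
        (∀ x ∈ F, ENNReal.ofReal (ε₀ ^ 3) ≤ ∫⁻ y in ball x (2 * r), ‖u t y‖ₑ ^ 3) →
        F.card ≤ N₀ := by
  intro ε₀ hε₀
  obtain ⟨V, hV⟩ :=
    Summit.NavierStokesRegularity.NavierStokesRegularity.Theorems.bounded_subslab_of_lerayHopf hν hsol hLH
      hdec T' hT'
  have hV0 : 0 ≤ V := (norm_nonneg _).trans (hV 0 ⟨le_rfl, hT'.1.le⟩ 0)
  set E₀ : ℝ := VectorCalculus.kineticEnergy (u 0) with hE₀
  have hE₀0 : 0 ≤ E₀ := Literature.Analysis.FluidPDE.kineticEnergy_nonneg (u 0)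
  set N₀ : ℕ := ⌊16 * V * E₀ / ε₀ ^ 3⌋₊ with hN₀
  refine ⟨N₀, fun t ht r hr F hsep hconc => ?_⟩
  have htT : t ∈ Icc 0 T := ⟨ht.1, ht.2.trans hT'.2.le⟩
  have htI : t ∈ Ico 0 T := ⟨ht.1, lt_of_le_of_lt ht.2 hT'.2⟩
  -- measurability of the slice
  have hcont : Continuous (u t) := (hsol.contDiff_velocity htI).continuous
  have hmeas : AEMeasurable (fun y => ‖u t y‖ₑ ^ 3) volume :=
    (hcont.measurable.enorm.pow_const _).aemeasurable
  -- bounded overlap of the balls `B(x, 2r)` for a `4r`-separated family: multiplicity `8`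
  have hsum := SparsenessTools.sum_setLIntegral_ball_le_of_separated (s := 4 * r) (ρ := 2 * r)
    (by positivity) (by positivity) F hsep hmeas
  have e8 : ((2 * r + 4 * r / 2) / (4 * r / 2)) ^ 3 = (8 : ℝ) := by
    field_simp
    ring
  rw [e8] at hsum
  -- `∫ |u(t)|³ ≤ V ∫ |u(t)|² ≤ V · 2E₀`
  have hL3 : ∫⁻ y, ‖u t y‖ₑ ^ 3 ≤ ENNReal.ofReal V * ENNReal.ofReal (2 * E₀) := by
    calc ∫⁻ y, ‖u t y‖ₑ ^ 3 ≤ ∫⁻ y, ENNReal.ofReal V * ‖u t y‖ₑ ^ 2 := by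
          refine lintegral_mono fun y => ?_
          rw [pow_succ', ← ofReal_norm]
          exact mul_le_mul' (ENNReal.ofReal_le_ofReal (hV t ht y)) le_rfl
      _ = ENNReal.ofReal V * ∫⁻ y, ‖u t y‖ₑ ^ 2 := lintegral_const_mul' _ _ ENNReal.ofReal_ne_top
      _ ≤ ENNReal.ofReal V * ENNReal.ofReal (2 * E₀) :=
          mul_le_mul' le_rfl (hLH.lintegral_enorm_sq_le hν.le htT)
  -- summing the concentration over `F`
  have hcard : (F.card : ℝ≥0∞) * ENNReal.ofReal (ε₀ ^ 3) ≤ ENNReal.ofReal (16 * V * E₀) := by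
    calc (F.card : ℝ≥0∞) * ENNReal.ofReal (ε₀ ^ 3) = ∑ x ∈ F, ENNReal.ofReal (ε₀ ^ 3) := by
          rw [Finset.sum_const, nsmul_eq_mul]
      _ ≤ ∑ x ∈ F, ∫⁻ y in ball x (2 * r), ‖u t y‖ₑ ^ 3 := Finset.sum_le_sum fun x hx => hconc x hx
      _ ≤ ENNReal.ofReal 8 * ∫⁻ y, ‖u t y‖ₑ ^ 3 := hsum
      _ ≤ ENNReal.ofReal 8 * (ENNReal.ofReal V * ENNReal.ofReal (2 * E₀)) := mul_le_mul' le_rfl hL3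
      _ = ENNReal.ofReal (16 * V * E₀) := by
          rw [← ENNReal.ofReal_mul hV0, ← ENNReal.ofReal_mul (by norm_num)]
          congr 1
          ring
  have hreal : (F.card : ℝ) * ε₀ ^ 3 ≤ 16 * V * E₀ := by
    have h1 := ENNReal.toReal_mono ENNReal.ofReal_ne_top hcard
    rwa [ENNReal.toReal_mul, ENNReal.toReal_natCast, ENNReal.toReal_ofReal (by positivity),
      ENNReal.toReal_ofReal (by positivity)] at h1
  have hle : (F.card : ℝ) ≤ 16 * V * E₀ / ε₀ ^ 3 := by
    rw [le_div_iff₀ (by positivity)]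
    exact hreal
  exact Nat.le_floor hle
end Summit.NavierStokesRegularity.NavierStokesRegularity.Theorems.EnstrophyQuarterLaw.SparsenessEarly

end
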